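import Summits.BirchSwinnertonDyer.BirchSwinnertonDyer.Theorems.ByReductionTypeAtTwoAdditiveKatoTransportDescentDoors
import Summits.BirchSwinnertonDyer.BirchSwinnertonDyer.Theorems.ByReductionTypeAtTwoAdditiveKatoTransportPrintExactAnyImageFinalDoors
import HarnessLib

/-!
# Route ByReductionTypeAtTwo, crux C4″ `AdditivePotMultOverKAtTwo` (stmt-BirchSwinnertonDyer-22618; parent
# `AdditiveRankZeroAtTwo` 19098) — the (−1)-split-twist block doors AT PRINT LEVEL keyed by the Literature CONSTRUCTION fact
# `Kato2004.exists_splitTwistDivisibilityInputsDescent_negOne_two` instead of the Summits `@[conjecture]` constant: the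
# Decomposition and Model levels of k4-w3's chain re-run (theorems only; part 1 of 2)

Cell `bsd-2adic`, seat `bsd-2adic-addL2x` GEN 17. Companion of `…AdditiveKatoTransportDescentDoors.lean` (base and torsion doors
from the fact). FIELD FOR FIELD the (−1)-block theorems of `…PrintExactAnyImageDecomposition.lean` (k4-w3 GEN 4),
`…PrintExactAnyImageModelDoors.lean` §1 (GEN 5), `…PrintExactAnyImagePrintDoors.lean` §1 (GEN 5) and
`…PrintExactAnyImageFinalDoors.lean` §3 (GEN 6), with `hPE : KatoOddBranchInputsAtTwoNegOneSplitTwistPrintExactAnyImage` replaced by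
`hDesc : Kato2004.exists_splitTwistDivisibilityInputsDescent_negOne_two` and, below the final level, the normalisation binder
`hγ5 : κ_cyc(γ) = 5` (which the final door discharges for EVERY generator by the WLOG `γ ↦ γ·c̃`, `c̃ ∈ ker κ` a complex
conjugation — `exists_mem_kerSubgroup_cyclotomicCharacter_mul_eq_five` — and which implies the model doors' `γ·i = i`,
`smul_eq_self_of_sq_eq_neg_one_of_cyclotomicCharacter_eq_five`). Every model / decomposition / functional-equation / isogeny /
non-vanishing ingredient is the cell's existing KERNEL theorem, imported BY NAME (t42 GEN 21–24, k4-w3 GEN 2–6, addL2x GEN 15–16).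

* §1 `lengthAt_selmerDual_le_of_splitTwistDescent_of_decomposition_fe` — Decomposition door (key `γ`).
* §2 `lengthAt_selmerDual_le_of_splitTwistDescent_fe_of_model` / `…Contra…_fe_of_model` — modulo the model `ΘS` over `F ∋ √−1`.
* (part 2, `…DescentFinalDoors.lean`) the model SUPPLIED (`…_fe_of_quadraticField…`), the print level and THE (−1)-BLOCK DOORS for
  EVERY generator `γ` and `r_an(W) = 0` (`katoDivisibility_negOneSplitTwist_two_of_descent_of_analyticRank_eq_zero`).

HONEST FRAMING (D-0036 / D-0054): theorems only — no definition, no named fact, no instance, no `sorry`; route-independent;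
CONDITIONAL on `Kato2004.thm12_4`, `Greenberg1999_thm114_charIdeal_iota_invariant`,
`Greenberg1999.thm114_charIdeal_iota_invariant_splitMult_baseChange`, `Greenberg1999.thm15_isTorsion_multiplicative_rat`,
`hasEntireLFunction_rat` (PRINT, BY NAME) and on the Literature construction fact
`Kato2004.exists_splitTwistDivisibilityInputsDescent_negOne_two` (review lane; debt +1); types-the-object-of (the Iwasawa-level
word of the (−1)-split-twist sub-block of C4″ becomes «PRINT ×5 + ONE Literature construction fact + `r_an(W) = 0` + the
objects themselves», the Summits `@[conjecture]` constant SUPERSEDED for this block); closes none (the block target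
`KatoSharpAtTwoAdditiveNegOneSplitTwist` still needs the descent READING T1–T14 and, on the irreducible part, (A)); nothing
booked; BSD is not proved by any of this. NOT HERE: the (−2)-block (reached from the (−1) statements at the twist by `2` by the
cell's kernel R15 at the level of the `@[conjecture]` packages; the END-level transport for the fact is a successor item).
PARTITION: X5@2 additive potentially-multiplicative block, the (−1)-split sub-block (169 classes; 128 irreducible, 41
reducible) × `p = 2`.

References: [Kato2004Asterisque] Thm. 12.4 (p. 221), Thm. 12.5 (3) with (12.5.1) (p. 222), Thm. 17.4 (1) (p. 273), §17.13
(pp. 279–280); [GreenbergLNM1716] §1 (p. 60), Thm. 1.5 (p. 61), Thm. 1.14 (p. 68), §4 (p. 107); [Greenberg1989] pp. 101–102;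
[GreenbergVatsal2000] §2 (p. 28); [MazurTateTeitelbaum1986Invent] §I.8, §I.12–I.14, §I.17; [Washington1997] §13.1;
memo `run/shared/lean/pub/bsd-2adic/addL2x/VERDICT-19098-addL2x-GEN17.md`.
-/

set_option autoImplicit false
-- the summit's namespace `Summit.BirchSwinnertonDyer.BirchSwinnertonDyer` (Sub = Summit) trips `dupNamespace`
set_option linter.dupNamespace false

noncomputable section

open scoped Classical MatrixGroups ModularForm NumberField

open Field CongruenceSubgroup WeierstrassCurve IsDedekindDomain Literature.NumberTheory.EllipticCurves
  Literature.NumberTheory.EllipticCurves.ModularForms Literature.NumberTheory.EllipticCurves.IwasawaAlgebra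
  Literature.NumberTheory.EllipticCurves.Module Literature.NumberTheory.EllipticCurves.QuadraticLayer
  Literature.NumberTheory.EllipticCurves.Greenberg1999 Literature.NumberTheory.GaloisRepresentations
  Summit.BirchSwinnertonDyer.BirchSwinnertonDyer.Theorems

namespace Summit.BirchSwinnertonDyer.BirchSwinnertonDyer.Theorems.AddKatoTwo

/-! ## §1 The Decomposition door, key `γ` -/

/-- **Decomposition door, (−1)-block, key `γ`, keyed by the Literature fact, FE in the kernel.** `ℓ_𝔮(X(W/ℚ_∞)) ≤ ℓ_𝔮(Λ/(L̃))`
at EVERY height-one `𝔮 ∌ 2` for `W` globally minimal, additive with `W^{(−1)}` split multiplicative at `2`, `κ_cyc(γ) = 5`, from: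
`Kato2004.thm12_4`, the construction fact `Kato2004.exists_splitTwistDivisibilityInputsDescent_negOne_two`, Greenberg Thm. 1.14
×2 applied to a globally minimal model `W'` of the twist over `ℚ` and over `F`, torsion finitely generated dual data `D_F`, `D'`,
the twist-decomposition in length form `hdec`, and `L̃ = 2^m·L⁻ ≠ 0`. The body of
`lengthAt_selmerDual_le_of_oddBranchInputsPrintExactAnyImage_of_decomposition_fe` with the key-`γ⁻¹` length-form door replaced by
`lengthAt_selmerDualContra_le_of_splitTwistDescent_of_lengthAt_symm_fe`.
[cite: Kato2004Asterisque, Thm. 12.4 (2) (p. 221), Thm. 12.5 (3) and (12.5.1) (p. 222), §17.3 (p. 273), §17.13 (pp. 279–280)]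
[cite: GreenbergLNM1716, Thm. 1.14 (p. 68), §4 (p. 107)] [cite: Greenberg1989, pp. 101–102 (S^ι)]
[cite: MazurTateTeitelbaum1986Invent, §I.17] -/
theorem lengthAt_selmerDual_le_of_splitTwistDescent_of_decomposition_fe (h12 : Kato2004.thm12_4)
    (hDesc : Kato2004.exists_splitTwistDivisibilityInputsDescent_negOne_two)
    (h114 : Greenberg1999_thm114_charIdeal_iota_invariant)
    (h114F : Greenberg1999.thm114_charIdeal_iota_invariant_splitMult_baseChange)
    (W : WeierstrassCurve ℚ) [W.IsElliptic] [W.IsGloballyMinimal] [ContinuousSMul ℤ_[2] (W.tateModule 2)]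
    {N : ℕ} [NeZero N] (f : CuspForm (Gamma0 N) 2) (κ : ZpExtension ℚ 2) (γ : absoluteGaloisGroup ℚ)
    (hsp : (W.quadraticTwist (-1)).HasSplitMultiplicativeReductionAtPrime 2)
    (hκ : κ.IsCyclotomic) (hγ : κ.IsTopGenerator γ)
    (hγ5 : ((GaloisRep.cyclotomicCharacter ℚ 2 γ : ℤ_[2]ˣ) : ℤ_[2]) = (cyclotomicGenerator 2 : ℤ_[2]))
    (hf : IsNewformOf (W.quadraticTwist (-1)) f)
    (I : Kato2004.IwasawaH1Data W 2 κ γ) (D : W.SelmerDualData κ γ)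
    -- the twist over `ℚ` and over `F`, with the decomposition reading in length form
    (W' : WeierstrassCurve ℚ) [W'.IsElliptic] [W'.IsGloballyMinimal] (hmult' : W'.HasMultiplicativeReductionAtPrime 2)
    (F : Type) [Field F] [NumberField F]
    (hF : ∀ v : HeightOneSpectrum (𝓞 F), (2 : 𝓞 F) ∈ v.asIdeal → (W'.baseChange F).HasSplitMultiplicativeReductionAt v)
    (κF : ZpExtension F 2) (γF : Field.absoluteGaloisGroup F) (hκF : κF.IsCyclotomic) (hγF : κF.IsTopGenerator γF)
    (DF : (W'.baseChange F).SelmerDualData κF γF) [Module.Finite (IwasawaAlgebra 2) DF.X] (hDF : DF.IsTorsion)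
    (D' : W'.SelmerDualData κ γ) [Module.Finite (IwasawaAlgebra 2) D'.X] (hD' : D'.IsTorsion)
    (hdec : ∀ 𝔮 : PrimeSpectrum (IwasawaAlgebra 2), 𝔮.asIdeal.height = 1 →
      PowerSeries.C (2 : ℤ_[2]) ∉ 𝔮.asIdeal →
      lengthAt (IwasawaAlgebra 2) DF.X 𝔮 = lengthAt (IwasawaAlgebra 2) D'.X 𝔮 + lengthAt (IwasawaAlgebra 2) D.X 𝔮)
    -- the `2`-adic `L`-function side
    (Lt : IwasawaAlgebra 2) (m : ℕ)
    (hLt : iwasawaToPowerSeries 2 Lt =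
      PowerSeries.C ((2 : ℚ_[2]) ^ m) * padicLFunctionMinusBranchMult f (1 : ℚ_[2]) 1)
    (hLt0 : Lt ≠ 0)
    (𝔮 : PrimeSpectrum (IwasawaAlgebra 2)) (h𝔮 : 𝔮.asIdeal.height = 1)
    (hp𝔮 : PowerSeries.C (2 : ℤ_[2]) ∉ 𝔮.asIdeal) :
    lengthAt (IwasawaAlgebra 2) D.X 𝔮 ≤
      lengthAt (IwasawaAlgebra 2) (IwasawaAlgebra 2 ⧸ Ideal.span {Lt}) 𝔮 := by
  haveI : Fact (Nat.Prime 2) := ⟨Nat.prime_two⟩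
  have hLtι : (Ideal.span {Lt}).map (invol 2).toRingHom = Ideal.span {Lt} :=
    MultOddBranchFE.map_invol_span_eq_of_eq_oddBranchMult_two_of_split hsp hf hLt
  -- length symmetry of `D` at every height-one prime `∌ 2` (T20 (a) by name + `hdec`)
  have hsymD : ∀ 𝔭 : PrimeSpectrum (IwasawaAlgebra 2), 𝔭.asIdeal.height = 1 →
      PowerSeries.C ((2 : ℕ) : ℤ_[2]) ∉ 𝔭.asIdeal →
      lengthAt (IwasawaAlgebra 2) D.X 𝔭 =
        lengthAt (IwasawaAlgebra 2) D.X (PrimeSpectrum.comap (invol 2).toRingHom 𝔭) := by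
    intro 𝔭 h𝔭 hp𝔭
    have hp𝔭' : PowerSeries.C (2 : ℤ_[2]) ∉ 𝔭.asIdeal := by exact_mod_cast hp𝔭
    exact lengthAt_selmerDual_symm_of_decomposition h114 h114F W' hmult' F hF κF γF hκF hγF DF hDF κ γ hκ hγ D' hD' D
      hdec 𝔭 h𝔭 hp𝔭'
  -- the key-`γ⁻¹` twist of `D` and its symmetry
  obtain ⟨Dι, e, he, -⟩ := Kato2004.selmerDualData_exists_involTwist (mul_inv_cancel γ) D
  -- the conjugate prime
  set 𝔮' := PrimeSpectrum.comap (invol 2).toRingHom 𝔮 with h𝔮'def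
  have h𝔮' : 𝔮'.asIdeal.height = 1 := by rw [h𝔮'def, Kato2004.height_comap_invol]; exact h𝔮
  have hp𝔮' : PowerSeries.C (2 : ℤ_[2]) ∉ 𝔮'.asIdeal := by
    intro h
    apply hp𝔮
    rw [h𝔮'def, PrimeSpectrum.comap_asIdeal, Ideal.mem_comap] at h
    change invol 2 (PowerSeries.C (2 : ℤ_[2])) ∈ 𝔮.asIdeal at h
    rwa [invol_C] at h
  have hp𝔮'' : PowerSeries.C ((2 : ℕ) : ℤ_[2]) ∉ 𝔮'.asIdeal := by exact_mod_cast hp𝔮'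
  have hsymι : lengthAt (IwasawaAlgebra 2) Dι.X 𝔮' =
      lengthAt (IwasawaAlgebra 2) Dι.X (PrimeSpectrum.comap (invol 2).toRingHom 𝔮') :=
    selmerDualContra_lengthAt_symm_of_lengthAt_symm D Dι 𝔮' (hsymD 𝔮' h𝔮' hp𝔮'')
  -- the key-`γ⁻¹` length-form door at `ι𝔮`
  have hA := lengthAt_selmerDualContra_le_of_splitTwistDescent_of_lengthAt_symm_fe h12 hDesc W f κ γ hsp hκ hγ hγ5 hf I Dι
    Lt m hLt hLt0 𝔮' h𝔮' hp𝔮' hsymι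
  -- transport back to key `γ` at `𝔮`
  rw [Kato2004.selmerDualData_lengthAt_eq_inv D Dι 𝔮,
    Kato2004.lengthAt_quotient_span_eq_comap_invol_of_map_invol_span_eq hLtι 𝔮]
  exact hA

/-! ## §2 The model doors (model over `ℚ(√−1)` given, then SUPPLIED) -/

section Model

variable (W : WeierstrassCurve ℚ) [W.IsElliptic] [W.IsGloballyMinimal] [ContinuousSMul ℤ_[2] (W.tateModule 2)]
  (W' : WeierstrassCurve ℚ) [W'.IsElliptic] [W'.IsGloballyMinimal] {V : VariableChange ℚ} (hV : V • W = W'.quadraticTwist (-1))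
  {θ : AlgebraicClosure ℚ} (hθ : θ ^ 2 = algebraMap ℚ (AlgebraicClosure ℚ) (-1))
  {N : ℕ} [NeZero N] (f : CuspForm (Gamma0 N) 2) (κ : ZpExtension ℚ 2) (γ : absoluteGaloisGroup ℚ)
  (hsp : (W.quadraticTwist (-1)).HasSplitMultiplicativeReductionAtPrime 2)
  (hκ : κ.IsCyclotomic) (hγ : κ.IsTopGenerator γ)
  (hγ5 : ((GaloisRep.cyclotomicCharacter ℚ 2 γ : ℤ_[2]ˣ) : ℤ_[2]) = (cyclotomicGenerator 2 : ℤ_[2]))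
  (hf : IsNewformOf (W.quadraticTwist (-1)) f) (I : Kato2004.IwasawaH1Data W 2 κ γ)
  -- the model of `Sel(W′/ℚ_∞(θ))` over a number field `F` (intended `ℚ(√−1)`) where `W′` is split multiplicative above `2`
  (F : Type) [Field F] [NumberField F]
  (hF : ∀ v : HeightOneSpectrum (𝓞 F), (2 : 𝓞 F) ∈ v.asIdeal → (W'.baseChange F).HasSplitMultiplicativeReductionAt v)
  (κF : ZpExtension F 2) (γF : absoluteGaloisGroup F) (hκF : κF.IsCyclotomic) (hγF : κF.IsTopGenerator γF)
  (DF : (W'.baseChange F).SelmerDualData κF γF) [(kerStab κ θ).Normal]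
  (ΘS : (W'.baseChange F).selmerInfty κF ≃+ W'.selmerGroupOver 2 (kerStab κ θ))
  (hΘS : ∀ s, ((ΘS ((W'.baseChange F).conjSelmerInfty κF γF s) : W'.selmerGroupOver 2 (kerStab κ θ)) :
      W'.subgroupH1 2 (kerStab κ θ)) = W'.conjH1 2 (kerStab κ θ) γ (ΘS s : W'.selmerGroupOver 2 (kerStab κ θ)))
  -- the `2`-adic `L`-function side: an integral multiple `L̃ = 2^m·L⁻ ≠ 0` of the odd branch
  (Lt : IwasawaAlgebra 2) (m : ℕ)
  (hLt : iwasawaToPowerSeries 2 Lt = PowerSeries.C ((2 : ℚ_[2]) ^ m) * padicLFunctionMinusBranchMult f (1 : ℚ_[2]) 1)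
  (hLt0 : Lt ≠ 0)

include hV hθ hsp hκ hγ hγ5 hf I hF hκF hγF DF hΘS hLt hLt0 in
/-- **(−1)-BLOCK DOOR, key `γ`, keyed by the Literature fact, modulo the model**: the body of
`lengthAt_selmerDual_le_of_oddBranchInputsPrintExactAnyImage_fe_of_model` with the torsion of `X(W/ℚ_∞)` from
`isTorsion_selmerDual_of_splitTwistDescent_of_doorMultiple` and the Decomposition door of §1; `γ·θ = θ` from `κ_cyc(γ) = 5`
(`smul_eq_self_of_sq_eq_neg_one_of_cyclotomicCharacter_eq_five`).
[cite: Kato2004Asterisque, Thm. 12.4 (p. 221), Thm. 12.5 (3) and (12.5.1) (p. 222), Thm. 17.4 (1) (p. 273), §17.13 (pp. 279–280)]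
[cite: GreenbergLNM1716, Thm. 1.5 (p. 61), Thm. 1.14 (p. 68), §4 (p. 107)] [cite: MazurTateTeitelbaum1986Invent, §I.17] -/
theorem lengthAt_selmerDual_le_of_splitTwistDescent_fe_of_model (h12 : Kato2004.thm12_4)
    (hDesc : Kato2004.exists_splitTwistDivisibilityInputsDescent_negOne_two)
    (h114 : Greenberg1999_thm114_charIdeal_iota_invariant)
    (h114F : Greenberg1999.thm114_charIdeal_iota_invariant_splitMult_baseChange) (h15 : thm15_isTorsion_multiplicative_rat) :
    ∀ (D : W.SelmerDualData κ γ) (𝔮 : PrimeSpectrum (IwasawaAlgebra 2)), 𝔮.asIdeal.height = 1 →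
      PowerSeries.C (2 : ℤ_[2]) ∉ 𝔮.asIdeal →
      lengthAt (IwasawaAlgebra 2) D.X 𝔮 ≤ lengthAt (IwasawaAlgebra 2) (IwasawaAlgebra 2 ⧸ Ideal.span {Lt}) 𝔮 := by
  intro D 𝔮 h𝔮 hp𝔮
  haveI : Fact (Nat.Prime 2) := ⟨Nat.prime_two⟩
  have hγθ : γ • θ = θ := smul_eq_self_of_sq_eq_neg_one_of_cyclotomicCharacter_eq_five hγ5 hθ
  -- the twist side: a key-`γ` datum of `W′`, finitely generated, torsion by Greenberg's Thm. 1.5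
  let D₀' : W'.SelmerDualData κ γ := W'.selmerDualData κ hγ
  haveI : Module.Finite (IwasawaAlgebra 2) D₀'.X := D₀'.module_finite_holds hγ
  haveI : Module.Finite (IwasawaAlgebra 2) DF.X := DF.module_finite_holds hγF
  have hmult' : W'.HasMultiplicativeReductionAtPrime 2 :=
    (hasSplitMultiplicativeReductionAtPrime_twistModel W W' (by norm_num) hV 2 hsp).hasMultiplicativeReductionAtPrime
  have hD₀' : D₀'.IsTorsion :=
    isTorsion_selmerDual_twistModel_of_thm15 h15 W W' hmult' (by norm_num) hV f hf κ γ hκ hγ D₀'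
  -- the additive side: torsion from the Literature fact
  have hD : D.IsTorsion :=
    isTorsion_selmerDual_of_splitTwistDescent_of_doorMultiple hDesc W f κ γ hsp hκ hγ hγ5 hf I D Lt m hLt hLt0
  -- the decomposition through the model
  have hDF : DF.IsTorsion := (AddKatoTwoQuadLayer.isTorsion_model_iff κ W' W hV hθ hγθ ΘS hΘS D₀' D DF).mpr ⟨hD₀', hD⟩
  exact lengthAt_selmerDual_le_of_splitTwistDescent_of_decomposition_fe h12 hDesc h114 h114F W f κ γ hsp hκ hγ hγ5 hf I D
    W' hmult' F hF κF γF hκF hγF DF hDF D₀' hD₀'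
    (fun 𝔮' _ hp𝔮' ↦ AddKatoTwoQuadLayer.hdec_of_model κ W' W hV hθ hγθ ΘS hΘS D₀' D DF 𝔮' hp𝔮') Lt m hLt hLt0 𝔮 h𝔮 hp𝔮

include hV hθ hsp hκ hγ hγ5 hf I hF hκF hγF DF hΘS hLt hLt0 in
/-- **(−1)-BLOCK DOOR, key `γ⁻¹` (the PRINT-EXACT currency), keyed by the Literature fact, modulo the model** — the key-`γ`
door at `ι𝔮` for the tree's key-`γ` datum, transported by `Kato2004.selmerDualData_lengthAt_inv_eq` and the functional equation.
[cite: Kato2004Asterisque, Thm. 12.5 (3) and (12.5.1) (p. 222), §17.13 (pp. 279–280)] [cite: GreenbergLNM1716, Thm. 1.14 (p. 68)]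
[cite: MazurTateTeitelbaum1986Invent, §I.17] [cite: Greenberg1989, pp. 101–102 (S^ι)] -/
theorem lengthAt_selmerDualContra_le_of_splitTwistDescent_fe_of_model (h12 : Kato2004.thm12_4)
    (hDesc : Kato2004.exists_splitTwistDivisibilityInputsDescent_negOne_two)
    (h114 : Greenberg1999_thm114_charIdeal_iota_invariant)
    (h114F : Greenberg1999.thm114_charIdeal_iota_invariant_splitMult_baseChange) (h15 : thm15_isTorsion_multiplicative_rat) :
    ∀ (D' : W.SelmerDualData κ γ⁻¹) (𝔮 : PrimeSpectrum (IwasawaAlgebra 2)), 𝔮.asIdeal.height = 1 →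
      PowerSeries.C (2 : ℤ_[2]) ∉ 𝔮.asIdeal →
      lengthAt (IwasawaAlgebra 2) D'.X 𝔮 ≤ lengthAt (IwasawaAlgebra 2) (IwasawaAlgebra 2 ⧸ Ideal.span {Lt}) 𝔮 := by
  intro D' 𝔮 h𝔮 hp𝔮
  haveI : Fact (Nat.Prime 2) := ⟨Nat.prime_two⟩
  set 𝔮' := PrimeSpectrum.comap (invol 2).toRingHom 𝔮 with h𝔮'def
  have h𝔮' : 𝔮'.asIdeal.height = 1 := by rw [h𝔮'def, Kato2004.height_comap_invol]; exact h𝔮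
  have hp𝔮' : PowerSeries.C (2 : ℤ_[2]) ∉ 𝔮'.asIdeal := by
    intro h
    apply hp𝔮
    rw [h𝔮'def, PrimeSpectrum.comap_asIdeal, Ideal.mem_comap] at h
    change invol 2 (PowerSeries.C (2 : ℤ_[2])) ∈ 𝔮.asIdeal at h
    rwa [invol_C] at h
  have hA := lengthAt_selmerDual_le_of_splitTwistDescent_fe_of_model W W' hV hθ f κ γ hsp hκ hγ hγ5 hf I F hF κF γF hκF
    hγF DF ΘS hΘS Lt m hLt hLt0 h12 hDesc h114 h114F h15 (W.selmerDualData κ hγ) 𝔮' h𝔮' hp𝔮'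
  rw [Kato2004.selmerDualData_lengthAt_inv_eq (W.selmerDualData κ hγ) D' 𝔮,
    Kato2004.lengthAt_quotient_span_eq_comap_invol_of_map_invol_span_eq
      (MultOddBranchFE.map_invol_span_eq_of_eq_oddBranchMult_two_of_split hsp hf hLt) 𝔮]
  exact hA

end Model

end Summit.BirchSwinnertonDyer.BirchSwinnertonDyer.Theorems.AddKatoTwo

end
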